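import Mathlib.Analysis.SpecialFunctions.Integrals.Basic
import Mathlib.MeasureTheory.Integral.IntervalIntegral.Basic
import HarnessLib

/-!
# A trigonometric polynomial tending to `0` at `+∞` is zero (tool for Burnol 2001, Thm. 1.5)

In the proof of Théorème 1.5 of Burnol's 2001 CRAS note (TeX l.409–416) a finite combination
`Σ c_{w,k}(log 1/t)^k t^{−w}` of the singular parts of the vectors `X^λ_{w,k}` is shown to vanish
term by term from its square-integrability near `t = 0⁺` ("Elle ne peut être de carré intégrable au
voisinage de l'origine que si il n'y a aucune contribution d'un couple `(k,w)` avec `Re(w) > 1/2`").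
When several `w` share the same real part, the implicit step is the uniqueness theorem for
trigonometric polynomials (in the variable `x = log 1/t`): **if `Σ_j c_j e^{iτ_j x} → 0` as
`x → +∞` with distinct real frequencies `τ_j`, then every `c_j = 0`** — by the Bohr mean value
`(1/X)∫_0^X T(x)e^{−iτ_l x}dx → c_l`.  This file proves that step
(`eq_zero_of_tendsto_trigPoly_atTop`).  RH-FREE.

## References
* [Burnol2001CRAS] J.-F. Burnol, C. R. Acad. Sci. Paris 333 (2001) 201–206, §1, proof of Thm. 1.5
  (TeX l.409–416).
-/

open MeasureTheory Set Filter Complex Metric intervalIntegral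
open scoped Real Topology

namespace Literature.Analysis.DeBrangesSpaces

namespace Burnol2001

/-- `‖e^{iτx}‖ = 1` for real `τ, x`. [folklore] -/
private theorem norm_cexp_I_mul_real (τ x : ℝ) : ‖cexp (I * τ * x)‖ = 1 := by
  rw [show (I * τ * x : ℂ) = ((τ * x : ℝ) : ℂ) * I by push_cast; ring, Complex.norm_exp_ofReal_mul_I]

/-- The Bohr mean of `e^{iσx}`, `σ ≠ 0`: `(1/X)∫_0^X e^{iσx}dx → 0` as `X → ∞`. [folklore] -/
private theorem tendsto_mean_cexp_I_mul {σ : ℝ} (hσ : σ ≠ 0) :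
    Tendsto (fun X : ℝ ↦ (X : ℂ)⁻¹ * ∫ x in (0 : ℝ)..X, cexp (I * σ * x)) atTop (𝓝 0) := by
  have hc : (I * σ : ℂ) ≠ 0 := mul_ne_zero I_ne_zero (ofReal_ne_zero.2 hσ)
  have hnc : ‖(I * σ : ℂ)‖ = |σ| := by rw [norm_mul, norm_I, one_mul, norm_real, Real.norm_eq_abs]
  have hform : ∀ X : ℝ, (∫ x in (0 : ℝ)..X, cexp (I * σ * x)) = (cexp (I * σ * X) - 1) / (I * σ) := by
    intro X
    have := integral_exp_mul_complex (a := 0) (b := X) hc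
    simp only [ofReal_zero, mul_zero, Complex.exp_zero] at this
    rw [← this]
  have hbound : ∀ X : ℝ, 0 < X → ‖(X : ℂ)⁻¹ * ∫ x in (0 : ℝ)..X, cexp (I * σ * x)‖ ≤ 2 / |σ| * X⁻¹ := by
    intro X hX
    rw [hform, norm_mul, norm_inv, norm_real, Real.norm_eq_abs, abs_of_pos hX, norm_div, hnc]
    have h1 : ‖cexp (I * σ * X) - 1‖ ≤ 2 := by
      calc ‖cexp (I * σ * X) - 1‖ ≤ ‖cexp (I * σ * X)‖ + ‖(1 : ℂ)‖ := norm_sub_le _ _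
        _ = 2 := by rw [norm_cexp_I_mul_real, norm_one]; norm_num
    rw [mul_comm]
    gcongr
  refine squeeze_zero_norm' (a := fun X ↦ 2 / |σ| * X⁻¹) ?_ ?_
  · filter_upwards [eventually_gt_atTop (0 : ℝ)] with X hX
    exact hbound X hX
  · have := tendsto_inv_atTop_zero.const_mul (2 / |σ|)
    rwa [mul_zero] at this

/-- Cesàro for integrals: if `g → 0` at `+∞` and `g` is locally integrable then `(1/X)∫_0^X g → 0`.
[folklore] -/
private theorem tendsto_mean_of_tendsto_zero {g : ℝ → ℂ} (hg : Continuous g)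
    (h0 : Tendsto g atTop (𝓝 0)) :
    Tendsto (fun X : ℝ ↦ (X : ℂ)⁻¹ * ∫ x in (0 : ℝ)..X, g x) atTop (𝓝 0) := by
  rw [Metric.tendsto_atTop]
  intro ε hε
  -- `‖g x‖ ≤ ε/2` for `x ≥ X₀`
  have h1 : ∀ᶠ x in atTop, ‖g x‖ ≤ ε / 2 := by
    have := (h0.norm).eventually (ge_mem_nhds (by rw [norm_zero]; linarith : ‖(0 : ℂ)‖ < ε / 2))
    exact this
  obtain ⟨X₀, hX₀⟩ := (eventually_atTop.1 h1)
  set X₁ : ℝ := max X₀ 1 with hX₁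
  have hX₁0 : 0 < X₁ := lt_of_lt_of_le one_pos (le_max_right _ _)
  set M : ℝ := ∫ x in (0 : ℝ)..X₁, ‖g x‖ with hM
  have hM0 : 0 ≤ M := intervalIntegral.integral_nonneg hX₁0.le fun x _ ↦ norm_nonneg _
  refine ⟨max X₁ (2 * M / ε + 1), fun X hX ↦ ?_⟩
  have hXX₁ : X₁ ≤ X := le_trans (le_max_left _ _) hX
  have hX0 : 0 < X := hX₁0.trans_le hXX₁
  have hXM : 2 * M / ε < X := by linarith [le_max_right X₁ (2 * M / ε + 1)]
  rw [dist_zero_right, norm_mul, norm_inv, norm_real, Real.norm_eq_abs, abs_of_pos hX0]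
  -- split the integral at `X₁`
  have hgi : ∀ a b : ℝ, IntervalIntegrable g volume a b := fun a b ↦ hg.intervalIntegrable _ _
  rw [← integral_add_adjacent_intervals (hgi 0 X₁) (hgi X₁ X)]
  have e1 : ‖∫ x in (0 : ℝ)..X₁, g x‖ ≤ M := by
    rw [hM]; exact norm_integral_le_integral_norm hX₁0.le
  have e2 : ‖∫ x in X₁..X, g x‖ ≤ ε / 2 * (X - X₁) := by
    have := norm_integral_le_of_norm_le_const (a := X₁) (b := X) (C := ε / 2) (f := g) fun x hx ↦ ?_
    · rwa [abs_of_nonneg (by linarith : 0 ≤ X - X₁)] at this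
    · rw [uIoc_of_le hXX₁] at hx
      exact hX₀ x (le_trans (le_max_left _ _) hx.1.le)
  have hXne : X ≠ 0 := hX0.ne'
  have hMX : M / X < ε / 2 := by
    rw [div_lt_iff₀ hX0]
    have : 2 * M < X * ε := by rwa [div_lt_iff₀ hε] at hXM
    linarith
  calc X⁻¹ * ‖(∫ x in (0 : ℝ)..X₁, g x) + ∫ x in X₁..X, g x‖
      ≤ X⁻¹ * (M + ε / 2 * (X - X₁)) := by
        gcongr
        exact (norm_add_le _ _).trans (add_le_add e1 e2)
    _ ≤ X⁻¹ * (M + ε / 2 * X) := by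
        gcongr
        linarith [hX₁0]
    _ = M / X + ε / 2 := by field_simp
    _ < ε := by linarith

/-- **A trigonometric polynomial with distinct real frequencies that tends to `0` at `+∞` is zero.**
If `Σ_{τ ∈ s} c_τ e^{iτx} → 0` as `x → +∞` then `c_τ = 0` for every `τ ∈ s` (Bohr mean values).
Implicit step of Burnol's elimination of the dominant singularities in the proof of Théorème 1.5.
[cite: Burnol2001CRAS, §1, proof of Théorème 1.5 (TeX l.409–416)] -/
theorem eq_zero_of_tendsto_trigPoly_atTop (s : Finset ℝ) (c : ℝ → ℂ)
    (h : Tendsto (fun x : ℝ ↦ ∑ τ ∈ s, c τ * cexp (I * τ * x)) atTop (𝓝 0)) :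
    ∀ τ ∈ s, c τ = 0 := by
  classical
  intro l hl
  -- demodulate: `g(x) = T(x) e^{−ilx} = c_l + Σ_{τ ≠ l} c_τ e^{i(τ−l)x} → 0`
  set g : ℝ → ℂ := fun x ↦ (∑ τ ∈ s, c τ * cexp (I * τ * x)) * cexp (-(I * l * x)) with hg
  have hn : Tendsto (fun x : ℝ ↦ ‖∑ τ ∈ s, c τ * cexp (I * τ * x)‖) atTop (𝓝 0) := by
    simpa using h.norm
  have hg0 : Tendsto g atTop (𝓝 0) := by
    refine squeeze_zero_norm (fun x ↦ le_of_eq ?_) hn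
    rw [hg]; dsimp only
    rw [norm_mul, show (-(I * l * x) : ℂ) = I * ((-l : ℝ) : ℂ) * x by push_cast; ring,
      norm_cexp_I_mul_real, mul_one]
  have hg_eq : ∀ x : ℝ, g x = c l + ∑ τ ∈ s.erase l, c τ * cexp (I * ((τ - l : ℝ) : ℂ) * x) := by
    intro x
    rw [hg]; dsimp only
    rw [Finset.sum_mul, ← Finset.add_sum_erase s _ hl]
    congr 1
    · rw [mul_assoc, ← Complex.exp_add, show (I * l * x + -(I * l * x) : ℂ) = 0 by ring,
        Complex.exp_zero, mul_one]
    · refine Finset.sum_congr rfl fun τ _ ↦ ?_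
      rw [mul_assoc, ← Complex.exp_add]
      congr 2
      push_cast; ring
  have hgc : Continuous g := by rw [hg]; fun_prop
  -- the mean of `g` tends to `0` …
  have hA0 := tendsto_mean_of_tendsto_zero hgc hg0
  -- … and to `c_l`
  have hA1 : Tendsto (fun X : ℝ ↦ (X : ℂ)⁻¹ * ∫ x in (0 : ℝ)..X, g x) atTop (𝓝 (c l)) := by
    have hform : ∀ X : ℝ, 0 < X → (X : ℂ)⁻¹ * ∫ x in (0 : ℝ)..X, g x =
        c l + ∑ τ ∈ s.erase l, c τ * ((X : ℂ)⁻¹ * ∫ x in (0 : ℝ)..X, cexp (I * ((τ - l : ℝ) : ℂ) * x)) := by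
      intro X hX
      have hX0 : (X : ℂ) ≠ 0 := ofReal_ne_zero.2 hX.ne'
      have i1 : IntervalIntegrable (fun _ : ℝ ↦ c l) volume 0 X := intervalIntegrable_const
      have i2 : ∀ τ ∈ s.erase l, IntervalIntegrable
          (fun x : ℝ ↦ c τ * cexp (I * ((τ - l : ℝ) : ℂ) * x)) volume 0 X := fun τ _ ↦
        (by fun_prop : Continuous fun x : ℝ ↦ c τ * cexp (I * ((τ - l : ℝ) : ℂ) * x)).intervalIntegrable 0 X
      have hSc : Continuous fun x : ℝ ↦ ∑ τ ∈ s.erase l, c τ * cexp (I * ((τ - l : ℝ) : ℂ) * x) :=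
        continuous_finsetSum _ fun τ _ ↦ by fun_prop
      have i3 := hSc.intervalIntegrable (μ := volume) 0 X
      rw [intervalIntegral.integral_congr (fun x _ ↦ hg_eq x), intervalIntegral.integral_add i1 i3,
        intervalIntegral.integral_const, intervalIntegral.integral_finsetSum i2]
      simp_rw [intervalIntegral.integral_const_mul]
      rw [sub_zero, Complex.real_smul, mul_add, ← mul_assoc, inv_mul_cancel₀ hX0, one_mul,
        Finset.mul_sum]
      congr 1
      refine Finset.sum_congr rfl fun τ _ ↦ ?_
      ring
    have hlim : Tendsto (fun X : ℝ ↦ c l + ∑ τ ∈ s.erase l,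
        c τ * ((X : ℂ)⁻¹ * ∫ x in (0 : ℝ)..X, cexp (I * ((τ - l : ℝ) : ℂ) * x))) atTop (𝓝 (c l)) := by
      have : Tendsto (fun X : ℝ ↦ ∑ τ ∈ s.erase l,
          c τ * ((X : ℂ)⁻¹ * ∫ x in (0 : ℝ)..X, cexp (I * ((τ - l : ℝ) : ℂ) * x))) atTop (𝓝 0) := by
        rw [show (0 : ℂ) = ∑ τ ∈ s.erase l, c τ * 0 by simp]
        refine tendsto_finsetSum _ fun τ hτ ↦ ?_
        have hτl : τ - l ≠ 0 := sub_ne_zero.2 (Finset.ne_of_mem_erase hτ)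
        exact (tendsto_mean_cexp_I_mul hτl).const_mul _
      have := this.const_add (c l)
      rwa [add_zero] at this
    refine hlim.congr' ?_
    filter_upwards [eventually_gt_atTop (0 : ℝ)] with X hX
    exact (hform X hX).symm
  exact tendsto_nhds_unique hA1 hA0

end Burnol2001

end Literature.Analysis.DeBrangesSpaces
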